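import Summits.QuantumFields.QCD.Theorems.QuarksAsStableActionStableActionBridgeStubTwistedTraceComparison
import Summits.QuantumFields.QCD.Theorems.QuarksAsStableActionStableActionBridgeStubThermalTraceAntitone

/-!
# Twisted two-point functions versus vacuum two-point functions (transfer-data form)
(crux `QuarksAsStableAction.StableActionBridge`, item stmt-QuantumFields-9737, line `Sketch`;
registered stubs `twisted_twoPoint_comparison` and `twisted_twoPoint_sub_vacuum_le`)

The lattice functional on a time-periodic torus of extent `L` with the fermionic twist `Γ = (−1)^F`
(a contraction fixing the vacuum `Ω` and commuting with the transfer matrix `T`) evaluates a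
two-point function as the twisted trace `Tr(Γ T^{L−n} A T^n B) / Tr(Γ T^L)`, while spectral /
Goldstone lower bounds live in the vacuum functional `⟪Ω, A T^n B Ω⟫`.  These two lemmas transfer
TWO-point functions between the two (the one-insertion case is `stub_twistedTraceComparison`,
p103562, and its normalised form `twisted_expectation_sub_vacuum_le`).

* `twisted_twoPoint_comparison`: since `Γ T = T Γ`, cyclicity of the trace gives
  `Tr(Γ T^{L−n} A T^n B) = Tr(Γ (A T^n B) T^{L−n})`, so the one-insertion comparison with
  `O := A T^n B` at extent `L − n` and `‖O‖ ≤ ‖A‖ ‖B‖` (`‖T^n‖ ≤ 1`) give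
  `‖Tr(Γ T^{L−n} A T^n B) − ⟪Ω, A T^n B Ω⟫‖ ≤ ‖A‖ ‖B‖ ε`, `ε := Re Tr T^{L−n} − 1 ≥ 0`.
* `twisted_twoPoint_sub_vacuum_le`: with `Z := Tr(Γ T^L)`, the comparison with `O = 1` at extent
  `L` and the antitonicity of `L ↦ Re Tr T^L` (`stub_thermalTraceAntitone`, p103305) give
  `‖Z − 1‖ ≤ ε_L ≤ ε < 1`, hence `‖Z‖ ≥ 1 − ε > 0`, and
  `N/Z − o = ((N − o) − (Z − 1) o)/Z` yields the bound `2 ‖A‖ ‖B‖ ε / (1 − ε)`.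
-/

namespace Summit.QuantumFields.QCD.Cruxes.StableActionBridge.Sketch

open scoped InnerProductSpace ComplexOrder
open Literature.Probability.LatticeModels

section Helpers

variable {H : Type} [NormedAddCommGroup H] [InnerProductSpace ℂ H] [CompleteSpace H]

omit [CompleteSpace H] in
/-- Powers of the transfer operator (a contraction) are contractions: `‖T^n‖ ≤ 1`. [folklore] -/
private theorem norm_transfer_pow_le_one (D : TransferData H) (n : ℕ) : ‖D.T ^ n‖ ≤ 1 := by
  induction n with
  | zero =>
    rw [pow_zero, ContinuousLinearMap.one_def]
    exact ContinuousLinearMap.norm_id_le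
  | succ n ih =>
    rw [pow_succ]
    calc ‖D.T ^ n * D.T‖ ≤ ‖D.T ^ n‖ * ‖D.T‖ := norm_mul_le _ _
      _ ≤ 1 * 1 := mul_le_mul ih D.norm_le_one (norm_nonneg _) zero_le_one
      _ = 1 := one_mul 1

omit [CompleteSpace H] in
/-- The dressed two-point insertion `A T^n B` has norm at most `‖A‖ ‖B‖`. [folklore] -/
private theorem norm_mul_transfer_pow_mul_le (D : TransferData H) (A B : H →L[ℂ] H) (n : ℕ) :
    ‖A * D.T ^ n * B‖ ≤ ‖A‖ * ‖B‖ := by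
  calc ‖A * D.T ^ n * B‖ ≤ ‖A * D.T ^ n‖ * ‖B‖ := norm_mul_le _ _
    _ ≤ ‖A‖ * 1 * ‖B‖ := by
        refine mul_le_mul_of_nonneg_right ?_ (norm_nonneg _)
        exact (norm_mul_le _ _).trans
          (mul_le_mul_of_nonneg_left (norm_transfer_pow_le_one D n) (norm_nonneg _))
    _ = ‖A‖ * ‖B‖ := by rw [mul_one]

omit [CompleteSpace H] in
/-- A Hilbert space carrying transfer data is non-trivial (it contains the unit vector `Ω`).
[folklore] -/
private theorem nontrivial_of_transferData (D : TransferData H) : Nontrivial H := by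
  refine ⟨⟨D.vacuum, 0, fun h0 => ?_⟩⟩
  have h1 := D.norm_vacuum
  rw [h0, norm_zero] at h1
  exact zero_ne_one h1

/-- The thermal smallness `Re Tr T^L − 1` is nonnegative (one-insertion comparison with
`Γ = O = 1`). [folklore] -/
private theorem thermal_smallness_nonneg [FiniteDimensional ℂ H] (D : TransferData H) (L : ℕ) :
    0 ≤ (LinearMap.trace ℂ H ((D.T ^ L : H →L[ℂ] H) : H →ₗ[ℂ] H)).re - 1 := by
  haveI : Nontrivial H := nontrivial_of_transferData D
  have hid : ‖(1 : H →L[ℂ] H)‖ = 1 := by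
    rw [ContinuousLinearMap.one_def]; exact ContinuousLinearMap.norm_id
  have h := stub_twistedTraceComparison H D 1 1 hid.le (one_apply_eq_self D.vacuum) L
  rw [hid] at h
  simp only [one_mul] at h
  exact (norm_nonneg _).trans h

/-- The twisted normaliser is close to `1`: `‖Tr(Γ T^L) − 1‖ ≤ Re Tr T^L − 1` (one-insertion
comparison with `O = 1`). [folklore] -/
private theorem norm_twisted_normaliser_sub_one_le [FiniteDimensional ℂ H] (D : TransferData H)
    (Γ : H →L[ℂ] H) (hΓ : ‖Γ‖ ≤ 1) (hΓΩ : Γ D.vacuum = D.vacuum) (L : ℕ) :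
    ‖LinearMap.trace ℂ H ((Γ * D.T ^ L : H →L[ℂ] H) : H →ₗ[ℂ] H) - 1‖ ≤
      (LinearMap.trace ℂ H ((D.T ^ L : H →L[ℂ] H) : H →ₗ[ℂ] H)).re - 1 := by
  haveI : Nontrivial H := nontrivial_of_transferData D
  have h := stub_twistedTraceComparison H D Γ 1 hΓ hΓΩ L
  have hid : ‖(1 : H →L[ℂ] H)‖ = 1 := by
    rw [ContinuousLinearMap.one_def]; exact ContinuousLinearMap.norm_id
  rw [hid, one_mul] at h
  simpa [inner_self_eq_norm_sq_to_K, D.norm_vacuum] using h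

end Helpers

/-- **Twisted two-point comparison.**  For transfer data `D = (T, Ω)` on a finite-dimensional
Hilbert space, a contraction `Γ` with `Γ Ω = Ω` commuting with `T`, bounded `A, B` and `n ≤ L`:
`‖Tr(Γ T^{L−n} A T^n B) − ⟪Ω, A T^n B Ω⟫‖ ≤ ‖A‖ ‖B‖ (Re Tr T^{L−n} − 1)` — cyclicity of the
trace moves `T^{L−n}` past `Γ`, then the one-insertion comparison with `O = A T^n B`. [folklore] -/
theorem twisted_twoPoint_comparison :
    ∀ (H : Type) [NormedAddCommGroup H] [InnerProductSpace ℂ H] [CompleteSpace H]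
      [FiniteDimensional ℂ H] (D : TransferData H) (Γ A B : H →L[ℂ] H),
      ‖Γ‖ ≤ 1 → Γ D.vacuum = D.vacuum → Γ * D.T = D.T * Γ → ∀ L n : ℕ, n ≤ L →
        ‖LinearMap.trace ℂ H ((Γ * D.T ^ (L - n) * A * D.T ^ n * B : H →L[ℂ] H) : H →ₗ[ℂ] H) -
            ⟪D.vacuum, (A * D.T ^ n * B) D.vacuum⟫_ℂ‖ ≤
          ‖A‖ * ‖B‖ *
            ((LinearMap.trace ℂ H ((D.T ^ (L - n) : H →L[ℂ] H) : H →ₗ[ℂ] H)).re - 1) := by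
  intro H _ _ _ _ D Γ A B hΓ hΓΩ hcomm L n _hn
  -- `Γ` commutes with the powers of `T`
  have hc : Commute Γ D.T := hcomm
  have hcpow : Γ * D.T ^ (L - n) = D.T ^ (L - n) * Γ := (hc.pow_right (L - n)).eq
  -- cyclicity of the trace: `Tr(Γ T^{L-n} A T^n B) = Tr(Γ (A T^n B) T^{L-n})`
  have hprod : Γ * D.T ^ (L - n) * A * D.T ^ n * B =
      D.T ^ (L - n) * (Γ * (A * D.T ^ n * B)) := by
    rw [hcpow]
    simp only [mul_assoc]
  have hcyc :
      LinearMap.trace ℂ H ((Γ * D.T ^ (L - n) * A * D.T ^ n * B : H →L[ℂ] H) : H →ₗ[ℂ] H) =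
        LinearMap.trace ℂ H
          ((Γ * (A * D.T ^ n * B) * D.T ^ (L - n) : H →L[ℂ] H) : H →ₗ[ℂ] H) := by
    rw [hprod, ContinuousLinearMap.toLinearMap_mul, LinearMap.trace_mul_comm,
      ← ContinuousLinearMap.toLinearMap_mul]
  rw [hcyc]
  refine (stub_twistedTraceComparison H D Γ (A * D.T ^ n * B) hΓ hΓΩ (L - n)).trans ?_
  exact mul_le_mul_of_nonneg_right (norm_mul_transfer_pow_mul_le D A B n)
    (thermal_smallness_nonneg D (L - n))

/-- **Twisted two-point expectation vs vacuum two-point expectation.**  For transfer data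
`D = (T, Ω)` on a finite-dimensional Hilbert space, a contraction `Γ` with `Γ Ω = Ω` commuting
with `T`, bounded `A, B`, `n ≤ L` and `ε := Re Tr T^{L−n} − 1 < 1`:
`‖Tr(Γ T^{L−n} A T^n B)/Tr(Γ T^L) − ⟪Ω, A T^n B Ω⟫‖ ≤ 2 ‖A‖ ‖B‖ ε / (1 − ε)` (the twisted
normaliser satisfies `‖Tr(Γ T^L) − 1‖ ≤ ε_L ≤ ε` by antitonicity of the thermal trace). [folklore] -/
theorem twisted_twoPoint_sub_vacuum_le :
    ∀ (H : Type) [NormedAddCommGroup H] [InnerProductSpace ℂ H] [CompleteSpace H]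
      [FiniteDimensional ℂ H] (D : TransferData H) (Γ A B : H →L[ℂ] H),
      ‖Γ‖ ≤ 1 → Γ D.vacuum = D.vacuum → Γ * D.T = D.T * Γ → ∀ L n : ℕ, n ≤ L →
        (LinearMap.trace ℂ H ((D.T ^ (L - n) : H →L[ℂ] H) : H →ₗ[ℂ] H)).re - 1 < 1 →
          ‖LinearMap.trace ℂ H
                  ((Γ * D.T ^ (L - n) * A * D.T ^ n * B : H →L[ℂ] H) : H →ₗ[ℂ] H) /
                LinearMap.trace ℂ H ((Γ * D.T ^ L : H →L[ℂ] H) : H →ₗ[ℂ] H) -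
              ⟪D.vacuum, (A * D.T ^ n * B) D.vacuum⟫_ℂ‖ ≤
            2 * (‖A‖ * ‖B‖) *
                ((LinearMap.trace ℂ H ((D.T ^ (L - n) : H →L[ℂ] H) : H →ₗ[ℂ] H)).re - 1) /
              (1 - ((LinearMap.trace ℂ H ((D.T ^ (L - n) : H →L[ℂ] H) : H →ₗ[ℂ] H)).re - 1)) := by
  intro H _ _ _ _ D Γ A B hΓ hΓΩ hcomm L n hn hε
  set ε : ℝ := (LinearMap.trace ℂ H ((D.T ^ (L - n) : H →L[ℂ] H) : H →ₗ[ℂ] H)).re - 1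
    with hε_def
  set t : ℂ := ⟪D.vacuum, (A * D.T ^ n * B) D.vacuum⟫_ℂ with ht
  set a : ℂ :=
    LinearMap.trace ℂ H ((Γ * D.T ^ (L - n) * A * D.T ^ n * B : H →L[ℂ] H) : H →ₗ[ℂ] H) - t
    with ha
  set b : ℂ := LinearMap.trace ℂ H ((Γ * D.T ^ L : H →L[ℂ] H) : H →ₗ[ℂ] H) - 1 with hb
  -- the two-point comparison, the normaliser bound (transferred to extent `L - n`), Cauchy–Schwarz
  have ha_le : ‖a‖ ≤ ‖A‖ * ‖B‖ * ε :=
    twisted_twoPoint_comparison H D Γ A B hΓ hΓΩ hcomm L n hn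
  have hb_le : ‖b‖ ≤ ε := by
    have h1 := norm_twisted_normaliser_sub_one_le D Γ hΓ hΓΩ L
    have hanti := stub_thermalTraceAntitone H D (Nat.sub_le L n)
    simp only at hanti
    rw [hb, hε_def]
    linarith
  have ht_le : ‖t‖ ≤ ‖A‖ * ‖B‖ := by
    calc ‖t‖ ≤ ‖D.vacuum‖ * ‖(A * D.T ^ n * B) D.vacuum‖ := norm_inner_le_norm _ _
      _ ≤ ‖D.vacuum‖ * (‖A * D.T ^ n * B‖ * ‖D.vacuum‖) :=
          mul_le_mul_of_nonneg_left ((A * D.T ^ n * B).le_opNorm _) (norm_nonneg _)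
      _ = ‖A * D.T ^ n * B‖ := by rw [D.norm_vacuum]; ring
      _ ≤ ‖A‖ * ‖B‖ := norm_mul_transfer_pow_mul_le D A B n
  -- algebra
  have hε0 : 0 ≤ ε := (norm_nonneg b).trans hb_le
  have hr1 : 0 < 1 - ε := by linarith
  have h1b : 1 - ε ≤ ‖1 + b‖ := by
    have h2 := norm_sub_norm_le (1 : ℂ) (-b)
    rw [norm_one, norm_neg, sub_neg_eq_add] at h2
    linarith
  have h1b_pos : 0 < ‖1 + b‖ := lt_of_lt_of_le hr1 h1b
  have h1b_ne : (1 + b) ≠ 0 := norm_pos_iff.1 h1b_pos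
  have hnum :
      LinearMap.trace ℂ H ((Γ * D.T ^ (L - n) * A * D.T ^ n * B : H →L[ℂ] H) : H →ₗ[ℂ] H) =
        t + a := by
    rw [ha]; ring
  have hden : LinearMap.trace ℂ H ((Γ * D.T ^ L : H →L[ℂ] H) : H →ₗ[ℂ] H) = 1 + b := by
    rw [hb]; ring
  rw [hnum, hden]
  have hrewrite : (t + a) / (1 + b) - t = (a - b * t) / (1 + b) := by
    field_simp
    ring
  rw [hrewrite, norm_div, div_le_div_iff₀ h1b_pos hr1]
  have hnum_le : ‖a - b * t‖ ≤ ‖A‖ * ‖B‖ * ε + ε * (‖A‖ * ‖B‖) := by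
    refine (norm_sub_le _ _).trans (add_le_add ha_le ?_)
    rw [norm_mul]
    exact mul_le_mul hb_le ht_le (norm_nonneg _) hε0
  calc ‖a - b * t‖ * (1 - ε) ≤ (‖A‖ * ‖B‖ * ε + ε * (‖A‖ * ‖B‖)) * (1 - ε) :=
        mul_le_mul_of_nonneg_right hnum_le hr1.le
    _ = 2 * (‖A‖ * ‖B‖) * ε * (1 - ε) := by ring
    _ ≤ 2 * (‖A‖ * ‖B‖) * ε * ‖1 + b‖ := by
        refine mul_le_mul_of_nonneg_left h1b ?_
        positivity

end Summit.QuantumFields.QCD.Cruxes.StableActionBridge.Sketch
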